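import Summits.CriticalPhenomena.PercolationContinuityZ3.Theorems.SahiMasterFamilyFInequalityAntipodalCertificate

/-!
# The `κ`-decomposition of the weighted antipodal form of `F`, and the class `A ∩ G ⊆ B`

Support file for the master-family `F`-inequality programme (`prim-master-conj` gen 25; `--supports stmt-CriticalPhenomena-4575`;
memo `run/shared/lean/prim/prim-l12/prim-master-conj/POINTWISE.md` §26).  No definition, no `sorry`, standard axioms.

Setting (as in `SahiMasterFamilyFInequalityAntipodalCertificate`): points of the cube are `s : Finset κ`, the antipode is the
complement `sᶜ`, families are `Finset (Finset κ)`, `Xᶜˢ` is the family of complements, and for a weight `ω` the weighted antipodal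
form of `F(A,B;G)` is
`WF(ω) = Σ_s ω s · c s`,  `c s = 𝟙_{A∩B∩G}(s) − 𝟙_{A∩G}(s)·𝟙_{B∩G}(sᶜ) − 𝟙_G(s)·𝟙_{(A∩B)∖G}(sᶜ)`
(`ω ≡ 1`: the combinatorial form `F_comb`; product measures are reached through the Bernstein/section hierarchy, §25.1).

Main results.

* `weightedFcomb_eq_kappa_decomposition` — for EVERY complement-invariant weight `ω` and ALL families `A, B, G` (no monotonicity needed),
  with `W = A ∩ B`, `V = A ∩ B ∩ G`, `C = A ∩ G`, `D = B ∩ G`: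
  `WF(ω) = [ω(W ∩ G) − ω(W ∩ Gᶜˢ)] + ω(V ∩ (G ∖ (A ∪ B))ᶜˢ) − ω((C ∖ B) ∩ (D ∖ A)ᶜˢ)`.
  The bracket is the antipodal-Harris atom `κ_ω(A∩B, G)` (nonnegative for upper families and FKG weights by
  `sum_inter_compls_le_sum_inter`), the middle term is nonnegative, and the last term is the weight of the "crossing" antipodal pairs
  `{c, cᶜ}` with `c ∈ (A∩G)∖B`, `cᶜ ∈ (B∩G)∖A`.  Hence `WF(ω) ≥ 0 ⟺ ω(crossing pairs of (A∩G, B∩G)) ≤ κ_ω(A∩B,G) + ω(V ∩ (G∖(A∪B))ᶜˢ)`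
  — the reduction behind the "strengthened Kleitman" conjecture (KC) of §26.
* `weightedFcomb_nonneg_of_inter_subset` — COROLLARY (new unconditional class, every complement-invariant FKG weight, every dimension):
  if `A ∩ B` and `G` are upper families and `A ∩ G ⊆ B` (or symmetrically `B ∩ G ⊆ A`), then `WF(ω) ≥ 0`.  With `ω ≡ 1` this is the
  coefficientwise (`F_comb`) positivity on that class, which contains `A = B` and `A ⊆ B`.

HONEST FRAMING: elementary bookkeeping (one involution `s ↦ sᶜ` and a 64-case pointwise identity) on top of the antipodal Harris atom;
`F ≥ 0` in general remains OPEN. [this work]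
-/

namespace Summit.CriticalPhenomena.PercolationContinuityZ3.Theorems

namespace TwistedAD

open Finset
open scoped FinsetFamily

variable {κ : Type*} [Fintype κ] [DecidableEq κ]

/-- Involution bookkeeping: `Σ_s ω s·𝟙_X(s)·𝟙_Y(sᶜ) = Σ_s ω s·𝟙_Y(s)·𝟙_X(sᶜ)` for a complement-invariant weight. [this work] -/
theorem sum_mul_ite_ite_compl_swap (ω : Finset κ → ℝ) (hsym : ∀ s, ω sᶜ = ω s) (X Y : Finset (Finset κ)) :
    ∑ s, ω s * ((if s ∈ X then (1 : ℝ) else 0) * (if sᶜ ∈ Y then (1 : ℝ) else 0))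
      = ∑ s, ω s * ((if s ∈ Y then (1 : ℝ) else 0) * (if sᶜ ∈ X then (1 : ℝ) else 0)) := by
  refine Fintype.sum_equiv (compl_involutive.toPerm _) _ _ fun s => ?_
  simp [hsym, mul_comm]

/-- Indicator sums as family weights: `Σ_s ω s·𝟙_X(s)·𝟙_Y(sᶜ) = Σ_{s ∈ X ∩ Yᶜˢ} ω s`. [this work] -/
theorem sum_mul_ite_ite_compl_eq (ω : Finset κ → ℝ) (X Y : Finset (Finset κ)) :
    ∑ s, ω s * ((if s ∈ X then (1 : ℝ) else 0) * (if sᶜ ∈ Y then (1 : ℝ) else 0)) = ∑ s ∈ X ∩ Yᶜˢ, ω s := by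
  rw [← univ_inter (X ∩ Yᶜˢ), ← sum_ite_mem]
  refine sum_congr rfl fun s _ => ?_
  by_cases h1 : s ∈ X <;> by_cases h2 : sᶜ ∈ Y <;> simp [h1, h2, mem_inter, mem_compls]

/-- Indicator sums as family weights: `Σ_s ω s·𝟙_X(s) = Σ_{s ∈ X} ω s`. [this work] -/
theorem sum_mul_ite_eq (ω : Finset κ → ℝ) (X : Finset (Finset κ)) :
    ∑ s, ω s * (if s ∈ X then (1 : ℝ) else 0) = ∑ s ∈ X, ω s := by
  rw [← univ_inter X, ← sum_ite_mem]
  refine sum_congr rfl fun s _ => ?_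
  by_cases h1 : s ∈ X <;> simp [h1]

/-- The pointwise identity behind the `κ`-decomposition (64 membership cases).  With `a = 𝟙_A(s)`, …, `g' = 𝟙_G(sᶜ)`:
`abg − (ag)(b'g') − ab(1−g)g' = [abg − ab·g'] + abg·g'(1−a')(1−b') − ag(1−b)·b'g'(1−a') + [abg·a'g'(1−b') − ag(1−b)·a'b'g']`. [this work] -/
private theorem pointwise_kappa_identity (A B G : Finset (Finset κ)) (s : Finset κ) :
    ((if s ∈ A ∩ B ∩ G then (1 : ℝ) else 0) - (if s ∈ A ∩ G then (1 : ℝ) else 0) * (if sᶜ ∈ B ∩ G then 1 else 0)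
        - (if s ∈ (A ∩ B) \ G then (1 : ℝ) else 0) * (if sᶜ ∈ G then 1 else 0))
      = ((if s ∈ (A ∩ B) ∩ G then (1 : ℝ) else 0) - (if s ∈ A ∩ B then (1 : ℝ) else 0) * (if sᶜ ∈ G then 1 else 0))
        + (if s ∈ A ∩ B ∩ G then (1 : ℝ) else 0) * (if sᶜ ∈ G \ (A ∪ B) then 1 else 0)
        - (if s ∈ (A ∩ G) \ B then (1 : ℝ) else 0) * (if sᶜ ∈ (B ∩ G) \ A then 1 else 0)
        + ((if s ∈ A ∩ B ∩ G then (1 : ℝ) else 0) * (if sᶜ ∈ (A ∩ G) \ B then 1 else 0)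
            - (if s ∈ (A ∩ G) \ B then (1 : ℝ) else 0) * (if sᶜ ∈ A ∩ B ∩ G then 1 else 0)) := by
  by_cases ha : s ∈ A <;> by_cases hb : s ∈ B <;> by_cases hg : s ∈ G <;>
    by_cases ha' : sᶜ ∈ A <;> by_cases hb' : sᶜ ∈ B <;> by_cases hg' : sᶜ ∈ G <;>
    simp [ha, hb, hg, ha', hb', hg', mem_inter, mem_sdiff, mem_union]

/-- **`κ`-decomposition of the weighted antipodal form of `F`.**  For every complement-invariant weight `ω` and all families
`A, B, G : Finset (Finset κ)`:
`Σ_s ω s·[𝟙_{A∩B∩G}(s) − 𝟙_{A∩G}(s)𝟙_{B∩G}(sᶜ) − 𝟙_G(s)𝟙_{(A∩B)∖G}(sᶜ)]`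
`= (Σ_{(A∩B)∩G} ω − Σ_{(A∩B)∩Gᶜˢ} ω) + Σ_{(A∩B∩G) ∩ (G∖(A∪B))ᶜˢ} ω − Σ_{((A∩G)∖B) ∩ ((B∩G)∖A)ᶜˢ} ω`.
The first bracket is `κ_ω(A∩B, G)`; the last sum is the weight of the crossing antipodal pairs of `(A∩G, B∩G)`. [this work] -/
theorem weightedFcomb_eq_kappa_decomposition (ω : Finset κ → ℝ) (hsym : ∀ s, ω sᶜ = ω s)
    (A B G : Finset (Finset κ)) :
    ∑ s, ω s * ((if s ∈ A ∩ B ∩ G then (1 : ℝ) else 0) - (if s ∈ A ∩ G then (1 : ℝ) else 0) * (if sᶜ ∈ B ∩ G then 1 else 0)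
              - (if s ∈ G then (1 : ℝ) else 0) * (if sᶜ ∈ (A ∩ B) \ G then 1 else 0))
      = ((∑ s ∈ (A ∩ B) ∩ G, ω s) - ∑ s ∈ (A ∩ B) ∩ Gᶜˢ, ω s)
        + (∑ s ∈ (A ∩ B ∩ G) ∩ (G \ (A ∪ B))ᶜˢ, ω s)
        - ∑ s ∈ ((A ∩ G) \ B) ∩ ((B ∩ G) \ A)ᶜˢ, ω s := by
  -- Step 1: swap the third term by the involution `s ↦ sᶜ`.
  have hswap3 : ∑ s, ω s * ((if s ∈ G then (1 : ℝ) else 0) * (if sᶜ ∈ (A ∩ B) \ G then (1 : ℝ) else 0))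
      = ∑ s, ω s * ((if s ∈ (A ∩ B) \ G then (1 : ℝ) else 0) * (if sᶜ ∈ G then (1 : ℝ) else 0)) :=
    sum_mul_ite_ite_compl_swap ω hsym G ((A ∩ B) \ G)
  -- Step 2: the antisymmetric bracket sums to zero.
  have hanti : ∑ s, ω s * ((if s ∈ A ∩ B ∩ G then (1 : ℝ) else 0) * (if sᶜ ∈ (A ∩ G) \ B then (1 : ℝ) else 0))
      = ∑ s, ω s * ((if s ∈ (A ∩ G) \ B then (1 : ℝ) else 0) * (if sᶜ ∈ A ∩ B ∩ G then (1 : ℝ) else 0)) :=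
    sum_mul_ite_ite_compl_swap ω hsym (A ∩ B ∩ G) ((A ∩ G) \ B)
  -- Step 3: rewrite the left side with the swapped third term, apply the pointwise identity, and split the sums.
  have hL : ∑ s, ω s * ((if s ∈ A ∩ B ∩ G then (1 : ℝ) else 0) - (if s ∈ A ∩ G then (1 : ℝ) else 0) * (if sᶜ ∈ B ∩ G then 1 else 0)
              - (if s ∈ G then (1 : ℝ) else 0) * (if sᶜ ∈ (A ∩ B) \ G then 1 else 0))
      = ∑ s, ω s * ((if s ∈ A ∩ B ∩ G then (1 : ℝ) else 0) - (if s ∈ A ∩ G then (1 : ℝ) else 0) * (if sᶜ ∈ B ∩ G then 1 else 0)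
              - (if s ∈ (A ∩ B) \ G then (1 : ℝ) else 0) * (if sᶜ ∈ G then 1 else 0)) := by
    have e1 : ∑ s, ω s * ((if s ∈ A ∩ B ∩ G then (1 : ℝ) else 0) - (if s ∈ A ∩ G then (1 : ℝ) else 0) * (if sᶜ ∈ B ∩ G then 1 else 0)
              - (if s ∈ G then (1 : ℝ) else 0) * (if sᶜ ∈ (A ∩ B) \ G then 1 else 0))
        = ∑ s, ω s * ((if s ∈ A ∩ B ∩ G then (1 : ℝ) else 0) - (if s ∈ A ∩ G then (1 : ℝ) else 0) * (if sᶜ ∈ B ∩ G then 1 else 0))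
          - ∑ s, ω s * ((if s ∈ G then (1 : ℝ) else 0) * (if sᶜ ∈ (A ∩ B) \ G then (1 : ℝ) else 0)) := by
      rw [← sum_sub_distrib]; exact sum_congr rfl fun s _ => by ring
    have e2 : ∑ s, ω s * ((if s ∈ A ∩ B ∩ G then (1 : ℝ) else 0) - (if s ∈ A ∩ G then (1 : ℝ) else 0) * (if sᶜ ∈ B ∩ G then 1 else 0)
              - (if s ∈ (A ∩ B) \ G then (1 : ℝ) else 0) * (if sᶜ ∈ G then 1 else 0))
        = ∑ s, ω s * ((if s ∈ A ∩ B ∩ G then (1 : ℝ) else 0) - (if s ∈ A ∩ G then (1 : ℝ) else 0) * (if sᶜ ∈ B ∩ G then 1 else 0))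
          - ∑ s, ω s * ((if s ∈ (A ∩ B) \ G then (1 : ℝ) else 0) * (if sᶜ ∈ G then (1 : ℝ) else 0)) := by
      rw [← sum_sub_distrib]; exact sum_congr rfl fun s _ => by ring
    rw [e1, e2, hswap3]
  rw [hL]
  have hP : ∑ s, ω s * ((if s ∈ A ∩ B ∩ G then (1 : ℝ) else 0) - (if s ∈ A ∩ G then (1 : ℝ) else 0) * (if sᶜ ∈ B ∩ G then 1 else 0)
              - (if s ∈ (A ∩ B) \ G then (1 : ℝ) else 0) * (if sᶜ ∈ G then 1 else 0))
      = ∑ s, ω s * (if s ∈ (A ∩ B) ∩ G then (1 : ℝ) else 0)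
        - ∑ s, ω s * ((if s ∈ A ∩ B then (1 : ℝ) else 0) * (if sᶜ ∈ G then (1 : ℝ) else 0))
        + ∑ s, ω s * ((if s ∈ A ∩ B ∩ G then (1 : ℝ) else 0) * (if sᶜ ∈ G \ (A ∪ B) then (1 : ℝ) else 0))
        - ∑ s, ω s * ((if s ∈ (A ∩ G) \ B then (1 : ℝ) else 0) * (if sᶜ ∈ (B ∩ G) \ A then (1 : ℝ) else 0))
        + (∑ s, ω s * ((if s ∈ A ∩ B ∩ G then (1 : ℝ) else 0) * (if sᶜ ∈ (A ∩ G) \ B then (1 : ℝ) else 0))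
            - ∑ s, ω s * ((if s ∈ (A ∩ G) \ B then (1 : ℝ) else 0) * (if sᶜ ∈ A ∩ B ∩ G then (1 : ℝ) else 0))) := by
    rw [← sum_sub_distrib, ← sum_sub_distrib, ← sum_add_distrib, ← sum_sub_distrib, ← sum_add_distrib]
    refine sum_congr rfl fun s _ => ?_
    rw [pointwise_kappa_identity A B G s]
    ring
  rw [hP, hanti, sub_self, add_zero, sum_mul_ite_eq, sum_mul_ite_ite_compl_eq, sum_mul_ite_ite_compl_eq,
    sum_mul_ite_ite_compl_eq]

/-- **The class `A ∩ G ⊆ B` (every dimension, every complement-invariant FKG weight).**  Let `ω ≥ 0` satisfy the FKG lattice condition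
and `ω sᶜ = ω s`.  If `A ∩ B` and `G` are upper families and `A ∩ G ⊆ B`, then the weighted antipodal form of `F(A,B;G)` is nonnegative:
`0 ≤ Σ_s ω s·[𝟙_{A∩B∩G}(s) − 𝟙_{A∩G}(s)𝟙_{B∩G}(sᶜ) − 𝟙_G(s)𝟙_{(A∩B)∖G}(sᶜ)]`.
Proof: in `weightedFcomb_eq_kappa_decomposition` the crossing family `((A∩G)∖B) ∩ …` is empty, the middle term is nonnegative, and
`κ_ω(A∩B,G) ≥ 0` is `sum_inter_compls_le_sum_inter`.  (By the symmetry `A ↔ B` of `F_comb`'s pair form the class `B ∩ G ⊆ A` follows for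
upper `A, B, G`; see `weightedFcomb_nonneg_of_inter_subset'`.) [this work] -/
theorem weightedFcomb_nonneg_of_inter_subset (ω : Finset κ → ℝ) (hω₀ : ∀ s, 0 ≤ ω s)
    (hω : ∀ s t, ω s * ω t ≤ ω (s ⊓ t) * ω (s ⊔ t)) (hsym : ∀ s, ω sᶜ = ω s)
    (A B G : Finset (Finset κ)) (hAB : IsUpperSet ((A ∩ B : Finset (Finset κ)) : Set (Finset κ)))
    (hG : IsUpperSet (G : Set (Finset κ))) (hsub : A ∩ G ⊆ B) :
    0 ≤ ∑ s, ω s * ((if s ∈ A ∩ B ∩ G then (1 : ℝ) else 0) - (if s ∈ A ∩ G then (1 : ℝ) else 0) * (if sᶜ ∈ B ∩ G then 1 else 0)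
              - (if s ∈ G then (1 : ℝ) else 0) * (if sᶜ ∈ (A ∩ B) \ G then 1 else 0)) := by
  rw [weightedFcomb_eq_kappa_decomposition ω hsym A B G]
  have hκ : ∑ s ∈ (A ∩ B) ∩ Gᶜˢ, ω s ≤ ∑ s ∈ (A ∩ B) ∩ G, ω s :=
    sum_inter_compls_le_sum_inter ω hω₀ hω hsym (A ∩ B) G hAB hG
  have hmid : 0 ≤ ∑ s ∈ (A ∩ B ∩ G) ∩ (G \ (A ∪ B))ᶜˢ, ω s := sum_nonneg fun s _ => hω₀ s
  have hcross : ∑ s ∈ ((A ∩ G) \ B) ∩ ((B ∩ G) \ A)ᶜˢ, ω s = 0 := by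
    apply sum_eq_zero
    intro s hs
    exfalso
    simp only [mem_inter, mem_compls, mem_sdiff] at hs
    exact hs.1.2 (hsub (mem_inter.2 hs.1.1))
  linarith

/-- The mirror class `B ∩ G ⊆ A`: here the crossing family is again empty (its second factor is), so the same decomposition applies.
Hypotheses: `A ∩ B` and `G` upper, `B ∩ G ⊆ A`. [this work] -/
theorem weightedFcomb_nonneg_of_inter_subset' (ω : Finset κ → ℝ) (hω₀ : ∀ s, 0 ≤ ω s)
    (hω : ∀ s t, ω s * ω t ≤ ω (s ⊓ t) * ω (s ⊔ t)) (hsym : ∀ s, ω sᶜ = ω s)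
    (A B G : Finset (Finset κ)) (hAB : IsUpperSet ((A ∩ B : Finset (Finset κ)) : Set (Finset κ)))
    (hG : IsUpperSet (G : Set (Finset κ))) (hsub : B ∩ G ⊆ A) :
    0 ≤ ∑ s, ω s * ((if s ∈ A ∩ B ∩ G then (1 : ℝ) else 0) - (if s ∈ A ∩ G then (1 : ℝ) else 0) * (if sᶜ ∈ B ∩ G then 1 else 0)
              - (if s ∈ G then (1 : ℝ) else 0) * (if sᶜ ∈ (A ∩ B) \ G then 1 else 0)) := by
  rw [weightedFcomb_eq_kappa_decomposition ω hsym A B G]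
  have hκ : ∑ s ∈ (A ∩ B) ∩ Gᶜˢ, ω s ≤ ∑ s ∈ (A ∩ B) ∩ G, ω s :=
    sum_inter_compls_le_sum_inter ω hω₀ hω hsym (A ∩ B) G hAB hG
  have hmid : 0 ≤ ∑ s ∈ (A ∩ B ∩ G) ∩ (G \ (A ∪ B))ᶜˢ, ω s := sum_nonneg fun s _ => hω₀ s
  have hcross : ∑ s ∈ ((A ∩ G) \ B) ∩ ((B ∩ G) \ A)ᶜˢ, ω s = 0 := by
    apply sum_eq_zero
    intro s hs
    exfalso
    simp only [mem_inter, mem_compls, mem_sdiff] at hs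
    exact hs.2.2 (hsub (mem_inter.2 hs.2.1))
  linarith

end TwistedAD

end Summit.CriticalPhenomena.PercolationContinuityZ3.Theorems
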